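import Summits.CriticalPhenomena.SAWScalingLimit.Theorems.SAWTotalPositivityTPToTraversalBoundChainPieces
import Summits.CriticalPhenomena.SAWScalingLimit.Theorems.SAWTotalPositivityTPToTraversalBoundCleanContractionAux
import Literature.Probability.RandomPlanarGeometry.PolylineDyadicClock

/-!
# Top state of the radial chain (`TopHeaviness`), part II: big pieces traverse catalogue annuli

Crux `SAWTotalPositivity.TPToTraversalBound` (stmt-CriticalPhenomena-10687), line `radial-portal-transfer`,
stub `stub_topHeaviness : TopHeaviness`.

Deterministic transfer from the line's lattice vocabulary (`HasPieces`: big maximal pieces of the walk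
outside a lattice box) to the Aizenman–Burchard vocabulary of the crux (`Curve.HasTraversals`: separate
traversals of a Euclidean annulus by the mesh polyline), in the direction OPPOSITE to
`stub_chain_transfer` of `…ChainTransfer`:

* `toCurve_dyadicTime`: in the dyadic `Path.trans` parametrisation of `polyline` the polyline of a walk
  is exactly at its `n`-th vertex at the Literature clock time `dyadicTime n = 1 - 2^{-n}`
  (`Literature.Probability.RandomPlanarGeometry.dyadicTime`, strictly increasing in `n`);
* `gridIdx`, `gridPt`: a grid of spacing `M = ⌊N/256⌋` (a catalogue of `≤ 1025²` annulus centres);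
* `exists_hasTraversals_of_hasPieces`: if the walk has `m + 1` maximal pieces of sup-diameter `≥ N/2`
  outside the open box `B_∞(c, N)`, `N ≥ 256`, then for some grid site `g` within sup-distance `N + M`
  of `c` the mesh polyline traverses the annulus `D(δ g; 2δM, 40δM)` (aspect ratio `20`) at least
  `(m - 1)/1025² + 1` separate times: every non-initial piece starts on the ring `supDist = N`, within
  `< M` of its grid site, and reaches sup-distance `≥ N/4 ≥ 64 M` from its start; pigeonhole over the
  catalogue, and the pieces are disjoint index intervals visited at increasing vertex times.

This is the combinatorial half of the reduction of `TopHeaviness` to an exponential tail for the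
number of separate traversals of deep fixed-ratio annuli (part III).
-/

noncomputable section

open MeasureTheory Filter Topology Set Metric
open scoped NNReal ENNReal unitInterval
open Literature.Probability.LatticeModels
open Literature.Probability.RandomPlanarGeometry
open Literature.Probability.RandomPlanarGeometry.SAW
open Summit.CriticalPhenomena.SAWScalingLimit.Theses.SAWTotalPositivity

namespace Summit.CriticalPhenomena.SAWScalingLimit.Theorems.TPToTraversalBound.Radial

/-! ## Vertex times of the polyline of a walk -/

section VertexTimes

variable {V E : Type*} [AddCommGroup E] [Module ℝ E] [TopologicalSpace E] [ContinuousAdd E]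
  [ContinuousSMul ℝ E] {G : SimpleGraph V}

/-- **The polyline of a walk is at its `n`-th vertex at time `1 - 2^{-n}`** (`n ≤` length; the
first segment is run on `[0, 1/2]`, and the rest of the walk, rescaled, on `[1/2, 1]`).
[cite: CamiaNewman2007, §2] -/
theorem toCurve_dyadicTime (emb : V → E) :
    ∀ {a b : V} (w : G.Walk a b) (n : ℕ), n ≤ w.length →
      w.toCurve emb (dyadicTime n) = emb (w.getVert n)
  | _, _, .nil, n, hn => by
    have hn0 : n = 0 := by simpa using hn
    subst hn0
    simp
  | a, _, .cons (v := b) h p, 0, _ => by simp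
  | a, _, .cons (v := b) h p, n + 1, hn => by
    have hp : p.toCurve emb = polyline (emb b :: (p.support.tail.map emb)) := by
      unfold SimpleGraph.Walk.toCurve
      rw [← p.cons_tail_support]
      rfl
    have hc : (SimpleGraph.Walk.cons h p).toCurve emb =
        polyline (emb a :: emb b :: (p.support.tail.map emb)) := by
      unfold SimpleGraph.Walk.toCurve
      rw [SimpleGraph.Walk.support_cons, ← p.cons_tail_support]
      rfl
    have hn' : n ≤ p.length := by
      rw [SimpleGraph.Walk.length_cons] at hn
      omega
    rw [hc]
    simp only [polyline, polylineFrom_cons, Path.coe_toContinuousMap,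
      SimpleGraph.Walk.getVert_cons_succ]
    rw [Path.trans_apply]
    split_ifs with ht
    · -- only `n = 0` reaches the first half: time `1/2`, end of the first segment
      have hn0 : n = 0 := by
        by_contra hne
        have h1 : (1 / 2 : ℝ) ^ (n + 1) < (1 / 2) ^ 1 :=
          pow_lt_pow_right_of_lt_one₀ (by norm_num) (by norm_num) (by omega)
        simp only [coe_dyadicTime] at ht
        linarith
      subst hn0
      have h1 : (⟨2 * (dyadicTime (0 + 1) : ℝ), (unitInterval.mul_pos_mem_iff zero_lt_two).2
          ⟨(dyadicTime (0 + 1)).2.1, ht⟩⟩ : I) = 1 := Subtype.ext (by simp [coe_dyadicTime]; norm_num)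
      rw [h1, Path.target, SimpleGraph.Walk.getVert_zero]
    · have h1 : (⟨2 * (dyadicTime (n + 1) : ℝ) - 1, unitInterval.two_mul_sub_one_mem_iff.2
          ⟨(not_le.1 ht).le, (dyadicTime (n + 1)).2.2⟩⟩ : I) = dyadicTime n :=
        Subtype.ext (by simp [coe_dyadicTime]; ring)
      rw [h1]
      have ih := toCurve_dyadicTime emb p n hn'
      rw [hp] at ih
      simpa only [polyline, Path.coe_toContinuousMap] using ih

end VertexTimes


variable {Ω : Set ℂ} {δ : ℝ} {u v : Site 2}

/-! ## A grid of annulus centres at lattice scale `M` -/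

/-- Grid index of a site relative to the centre `c` at spacing `M`: the coordinatewise floor
quotient of `p - c` by `M`. [folklore] -/
def gridIdx (c : Site 2) (M : ℕ) (p : Site 2) : Site 2 := fun l => (p l - c l) / (M : ℤ)

/-- The grid site with index `q`: `c + M q`. [folklore] -/
def gridPt (c : Site 2) (M : ℕ) (q : Site 2) : Site 2 := fun l => c l + (M : ℤ) * q l

/-- Every site is within sup-distance `< M` of its grid site. [folklore] -/
theorem supDist_gridPt_gridIdx_lt {c : Site 2} {M : ℕ} (hM : 1 ≤ M) (p : Site 2) :
    supDist p (gridPt c M (gridIdx c M p)) < M := by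
  have hM' : (0 : ℤ) < M := by exact_mod_cast hM
  have key : ∀ l, |p l - gridPt c M (gridIdx c M p) l| < M := by
    intro l
    simp only [gridPt, gridIdx]
    have h1 := Int.emod_add_mul_ediv (p l - c l) M
    have h2 := Int.emod_nonneg (p l - c l) hM'.ne'
    have h3 := Int.emod_lt_of_pos (p l - c l) hM'
    rw [abs_lt]
    constructor <;> linarith
  exact max_lt (key 0) (key 1)

/-- Grid sites with index in the cube `{-A, …, A}²` are within sup-distance `M A` of the centre.
[folklore] -/
theorem supDist_gridPt_le (c : Site 2) (M : ℕ) {q : Site 2} {A : ℕ} (hq : q ∈ box 2 A) :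
    supDist (gridPt c M q) c ≤ M * A := by
  rw [mem_box] at hq
  have key : ∀ l, |gridPt c M q l - c l| ≤ M * A := by
    intro l
    have h1 : |q l| ≤ A := abs_le.2 ⟨(hq l).1, (hq l).2⟩
    simp only [gridPt, add_sub_cancel_left, abs_mul]
    rw [abs_of_nonneg (by positivity : (0 : ℤ) ≤ M)]
    exact mul_le_mul_of_nonneg_left h1 (by positivity)
  exact max_le (key 0) (key 1)

/-- The grid index of a site within sup-distance `N` of the centre lies in the cube
`{-(N/M + 1), …, N/M + 1}²`. [folklore] -/
theorem gridIdx_mem_box {c : Site 2} {M N : ℕ} (hM : 1 ≤ M) {p : Site 2} (hp : supDist p c ≤ N) :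
    gridIdx c M p ∈ box 2 (N / M + 1) := by
  rw [mem_box]
  intro l
  have hM' : (0 : ℤ) < M := by exact_mod_cast hM
  obtain ⟨hlo, hhi⟩ := abs_le.1 ((abs_sub_le_supDist p c l).trans hp)
  have hQ : (((N / M : ℕ) : ℤ)) = (N : ℤ) / (M : ℤ) := Int.natCast_div N M
  have hlt : N < N / M * M + M := Nat.lt_div_mul_add hM
  have hlt' : (N : ℤ) < (N / M : ℕ) * M + M := by exact_mod_cast hlt
  simp only [gridIdx]
  push_cast
  constructor
  · refine Int.le_ediv_of_mul_le hM' ?_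
    nlinarith
  · calc (p l - c l) / (M : ℤ) ≤ (N : ℤ) / (M : ℤ) := Int.ediv_le_ediv hM' hhi
      _ = ((N / M : ℕ) : ℤ) := hQ.symm
      _ ≤ ((N / M : ℕ) : ℤ) + 1 := by linarith

/-- The number of grid indices in play is at most `1025²` once `N < 512 M`. [folklore] -/
theorem card_box_gridIdx_le {M N : ℕ} (hM : 1 ≤ M) (hN : N < 512 * M) :
    (box 2 (N / M + 1)).card ≤ 1025 ^ 2 := by
  rw [card_box]
  have h1 : N / M < 512 := (Nat.div_lt_iff_lt_mul (by omega)).2 hN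
  have h2 : 2 * (N / M + 1) + 1 ≤ 1025 := by omega
  exact Nat.pow_le_pow_left h2 2

/-! ## Big pieces traverse a catalogue annulus -/

/-- A non-initial maximal outside piece starts within sup-distance `N` of the centre (its
predecessor along the walk is a vertex of the open box, one lattice step away). [folklore] -/
theorem IsOutsidePiece.supDist_start_le {γ : DomainSAW Ω δ u v} {c : Site 2} {N i j : ℕ}
    (h : IsOutsidePiece γ c N i j) (hi : i ≠ 0) : supDist (γ.walk.getVert i) c ≤ N := by
  obtain ⟨hij, hjl, -, hstart, -⟩ := h
  have hin : supDist (γ.walk.getVert (i - 1)) c < N := hstart.resolve_left hi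
  have hlt : i - 1 < γ.walk.length := by omega
  have h1 := supDist_getVert_succ_le γ hlt
  rw [show i - 1 + 1 = i by omega, supDist_comm] at h1
  have h2 := supDist_triangle (γ.walk.getVert i) (γ.walk.getVert (i - 1)) c
  omega

/-- In a big piece (sup-diameter `≥ N/2`) some vertex is at sup-distance `≥ N/4` from the start of
the piece. [folklore] -/
theorem exists_far_index (γ : DomainSAW Ω δ u v) {N i j : ℕ}
    (h : ∃ t t', i ≤ t ∧ t ≤ j ∧ i ≤ t' ∧ t' ≤ j ∧
      (N : ℤ) ≤ 2 * supDist (γ.walk.getVert t) (γ.walk.getVert t')) :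
    ∃ φ, i ≤ φ ∧ φ ≤ j ∧ (N : ℤ) ≤ 4 * supDist (γ.walk.getVert i) (γ.walk.getVert φ) := by
  obtain ⟨t, t', h1, h2, h3, h4, h5⟩ := h
  have htri := supDist_triangle (γ.walk.getVert t) (γ.walk.getVert i) (γ.walk.getVert t')
  rw [supDist_comm (γ.walk.getVert t) (γ.walk.getVert i)] at htri
  by_cases ht : (N : ℤ) ≤ 4 * supDist (γ.walk.getVert i) (γ.walk.getVert t)
  · exact ⟨t, h1, h2, ht⟩
  · refine ⟨t', h3, h4, ?_⟩
    push Not at ht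
    omega


/-! ## Big pieces give separate traversals of one catalogue annulus -/

/-- Scale bookkeeping: `M = ⌊N/256⌋ ≥ 1`, `256 M ≤ N < 512 M` for `N ≥ 256`. [folklore] -/
theorem scaleM_bounds {N : ℕ} (hN : 256 ≤ N) :
    1 ≤ N / 256 ∧ 256 * (N / 256) ≤ N ∧ N < 512 * (N / 256) := by
  have h1 : 1 ≤ N / 256 := (Nat.le_div_iff_mul_le (by norm_num)).2 (by omega)
  have h2 : 256 * (N / 256) ≤ N := Nat.mul_div_le N 256
  have h3 : N < N / 256 * 256 + 256 := Nat.lt_div_mul_add (by norm_num)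
  exact ⟨h1, h2, by omega⟩

/-- **Big pieces traverse a catalogue annulus.** If a SAW has `m + 1` maximal pieces of sup-diameter
`≥ N/2` outside the open box `B_∞(c, N)` with `N ≥ 256` and `m ≥ 1`, then, with `M = ⌊N/256⌋`, for
some grid index `q` in the cube `{-(N/M+1), …, N/M+1}²` the mesh polyline of the walk traverses the
annulus `D(δ(c + Mq); 2δM, 40δM)` (aspect ratio `20`) at least `(m-1)/1025² + 1` separate times.
[folklore] -/
theorem exists_hasTraversals_of_hasPieces : ∀ {Ω : Set ℂ} {δ : ℝ} {u v : Site 2}, 0 < δ →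
    ∀ (γ : DomainSAW Ω δ u v) {c : Site 2} {N m : ℕ}, 256 ≤ N → 1 ≤ m →
    HasPieces γ c N N (m + 1) →
    ∃ q ∈ box 2 (N / (N / 256) + 1),
      (⟨γ.walk.toCurve (meshPoint δ)⟩ : Curve ℂ).HasTraversals ((m - 1) / 1025 ^ 2 + 1)
        (meshPoint δ (gridPt c (N / 256) q)) (2 * δ * (N / 256 : ℕ)) (40 * δ * (N / 256 : ℕ)) := by
  intro Ω δ u v hδ γ c N m hN hm h
  classical
  obtain ⟨hM1, hNM, hN256⟩ := scaleM_bounds hN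
  set M : ℕ := N / 256 with hM
  obtain ⟨i, j, hi, hk⟩ := h
  have hpiece : ∀ k, IsOutsidePiece γ c N (i k) (j k) := fun k => (hk k).1
  have hlen : ∀ k, j k ≤ γ.walk.length := fun k => (hpiece k).2.1
  -- far indices
  have hfar := fun k => exists_far_index γ (hk k).2
  choose φ hiφ hφj hφ using hfar
  -- the non-initial pieces start near the ring
  have hpos : ∀ k : Fin m, i k.succ ≠ 0 := fun k => by
    have := hi (Fin.succ_pos k); omega
  have hstart : ∀ k : Fin m, supDist (γ.walk.getVert (i k.succ)) c ≤ N := fun k =>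
    (hpiece k.succ).supDist_start_le (hpos k)
  -- pigeonhole on the grid index of the start
  set f : Fin m → Site 2 := fun k => gridIdx c M (γ.walk.getVert (i k.succ)) with hf
  set T : Finset (Site 2) := box 2 (N / M + 1) with hT
  have hmaps : ∀ k ∈ (Finset.univ : Finset (Fin m)), f k ∈ T := fun k _ =>
    gridIdx_mem_box hM1 (hstart k)
  have hcardT : T.card ≤ 1025 ^ 2 := card_box_gridIdx_le hM1 hN256
  set n : ℕ := (m - 1) / 1025 ^ 2 with hn
  have hn' : T.card * n < (Finset.univ : Finset (Fin m)).card := by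
    rw [Finset.card_univ, Fintype.card_fin]
    have h1 : T.card * n ≤ 1025 ^ 2 * n := Nat.mul_le_mul_right _ hcardT
    have h2 : 1025 ^ 2 * n ≤ m - 1 := Nat.mul_div_le (m - 1) (1025 ^ 2)
    omega
  obtain ⟨q, hqT, hfib⟩ := Finset.exists_lt_card_fiber_of_mul_lt_card_of_maps_to hmaps hn'
  refine ⟨q, hqT, ?_⟩
  -- the fibre, in increasing order
  set F : Finset (Fin m) := Finset.univ.filter (fun k => f k = q) with hF
  set e := F.orderEmbOfFin rfl with he
  have heF : ∀ ι, f (e ι) = q := fun ι => by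
    have hmem : e ι ∈ Finset.univ.filter (fun k => f k = q) := F.orderEmbOfFin_mem rfl ι
    exact (Finset.mem_filter.1 hmem).2
  set κ : Fin F.card → Fin (m + 1) := fun ι => (e ι).succ with hκ
  have hκmono : StrictMono κ := fun ι ι' h => Fin.succ_lt_succ_iff.2 (e.strictMono h)
  -- the traversals
  set g : Site 2 := gridPt c M q with hg
  have hnear : ∀ ι, supDist (γ.walk.getVert (i (κ ι))) g < M := fun ι => by
    have h1 := supDist_gridPt_gridIdx_lt (c := c) hM1 (γ.walk.getVert (i (κ ι)))
    have hq : gridIdx c M (γ.walk.getVert (i (κ ι))) = q := heF ι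
    rwa [hq] at h1
  have hNM' : (256 * M : ℤ) ≤ (N : ℤ) := by exact_mod_cast hNM
  have hfarg : ∀ ι, (40 * M : ℤ) ≤ supDist (γ.walk.getVert (φ (κ ι))) g := fun ι => by
    have h1 := hnear ι
    have h3 := hφ (κ ι)
    have h4 := supDist_triangle (γ.walk.getVert (i (κ ι))) g (γ.walk.getVert (φ (κ ι)))
    rw [supDist_comm g (γ.walk.getVert (φ (κ ι)))] at h4
    omega
  have htrav : (⟨γ.walk.toCurve (meshPoint δ)⟩ : Curve ℂ).HasTraversals F.card
      (meshPoint δ g) (2 * δ * M) (40 * δ * M) := by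
    refine ⟨fun ι => dyadicTime (i (κ ι)), fun ι => dyadicTime (φ (κ ι)), fun ι => ?_, ?_⟩
    · refine ⟨dyadicTime_strictMono.monotone (hiφ _), Or.inl ⟨?_, ?_⟩⟩
      · -- near: the start is within `< M` of its grid site
        show dist (γ.walk.toCurve (meshPoint δ) (dyadicTime (i (κ ι)))) (meshPoint δ g) ≤ 2 * δ * M
        rw [toCurve_dyadicTime (meshPoint δ) γ.walk _ ((hiφ _).trans ((hφj _).trans (hlen _)))]
        have h2 := dist_meshPoint_le hδ.le (γ.walk.getVert (i (κ ι))) g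
        have h3 : (supDist (γ.walk.getVert (i (κ ι))) g : ℝ) ≤ M := by
          exact_mod_cast (hnear ι).le
        calc dist (meshPoint δ (γ.walk.getVert (i (κ ι)))) (meshPoint δ g)
            ≤ 2 * δ * supDist (γ.walk.getVert (i (κ ι))) g := h2
          _ ≤ 2 * δ * M := mul_le_mul_of_nonneg_left h3 (by positivity)
      · -- far: a vertex of the piece at sup-distance `≥ 40 M` from the grid site
        show (40 * δ * M : ℝ) ≤
          dist (γ.walk.toCurve (meshPoint δ) (dyadicTime (φ (κ ι)))) (meshPoint δ g)
        rw [toCurve_dyadicTime (meshPoint δ) γ.walk _ ((hφj _).trans (hlen _))]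
        have h2 := le_dist_meshPoint hδ.le (γ.walk.getVert (φ (κ ι))) g
        have h5 : ((40 * M : ℤ) : ℝ) ≤ (supDist (γ.walk.getVert (φ (κ ι))) g : ℝ) := by
          exact_mod_cast hfarg ι
        push_cast at h5
        calc (40 * δ * M : ℝ) = δ * (40 * M) := by ring
          _ ≤ δ * supDist (γ.walk.getVert (φ (κ ι))) g := mul_le_mul_of_nonneg_left h5 hδ.le
          _ ≤ dist (meshPoint δ (γ.walk.getVert (φ (κ ι)))) (meshPoint δ g) := h2
    · intro ι ι' hlt
      refine dyadicTime_strictMono ?_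
      calc φ (κ ι) ≤ j (κ ι) := hφj _
        _ < i (κ ι') := HasPieces.lt_of_lt hi hpiece (hκmono hlt)
  exact htrav.of_le (show (m - 1) / 1025 ^ 2 + 1 ≤ F.card by omega)

end Summit.CriticalPhenomena.SAWScalingLimit.Theorems.TPToTraversalBound.Radial

end
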